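import Literature.NumberTheory.Automorphic.PairLFunctionPolesGLOneProofs
import Literature.NumberTheory.GaloisRepresentations.HeckeLFunctionNonvanishingProofs
import Literature.NumberTheory.GaloisRepresentations.HeckeCharacterNormOneProofs
import HarnessLib

/-!
# Arthur–Clozel (2.2) at `s = 1` for `GL_1` over any number field, from Hecke's continuation

Topic `NumberTheory/Automorphic`; namespace `Literature.NumberTheory.Automorphic`. Proof file
(theorems only: no definition, no named fact, no instance, no `sorry`) under the named fact
`JacquetShalika1981_partialPairL_at_one_of_ne_conj` of `PairLFunctionPoles` — Arthur–Clozel,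
*Simple algebras, base change, and the advanced theory of the trace formula*, Ann. of Math.
Stud. 120 (1989), Ch. 3 §2, (2.2), p. 171 of the held copy, at `s₀ = 1` for unitary cuspidal
`π ≇ σ̃` on `GL_n(𝔸_K)`: `L^S(s, π ⊗ σ)` "extends continuously to the line `Re s = 1`" and "does
not vanish there" — here in rank `n = 1` over an **arbitrary number field** `K`.

`PairLFunctionPolesGLOneProofs` reduced the case `n = 1` to its classical content
(`JacquetShalika1981_partialPairL_at_one_of_ne_conj_one_of_heckeCharacter`): for every unitary
Hecke character `ψ` of `K` trivial on `A_G = ℝ_{>0}` with `ψ ≠ 1` and every finite `S` off which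
`ψ` is unramified, `L^S(s, ψ)` has a finite non-zero limit as `s → 1`, `Re s > 1`. In print this
is Iwasawa, *Hecke's `L`-functions* (Princeton lectures, 1964), Thm. 3.1 (PDF p. 58: "If `χ ≢ 1`,
then `L(s; χ)` is holomorphic everywhere") with Prop. 4.4 (PDF p. 72: "`L(1 + iy; χ) ≠ 0`"), for
Iwasawa's "Hecke characters of `F`" = characters of the idele group trivial on `F^* × T`, `T` the
diagonal positive reals at the archimedean places (PDF p. 25) — exactly the present `ψ`
(`Automorphic.posRealIdele`). `PairLFunctionPolesGLOneRatProofs` proved it for `K = ℚ`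
(Dirichlet, Mathlib). This file proves it for all `K` **granted Hecke's continuation theorem** in
the tree's form, the named fact
`GaloisRepresentations.heckeLFunction_hasEntireContinuation_of_not_isNormTwist χ` (Tate (1950),
Thm. 4.4.1: `L(s, χ)` is entire for unitary `χ` not a norm twist `‖·‖^{it}`), the non-vanishing
`L(1, ψ) ≠ 0` being the tree's theorem
`GaloisRepresentations.HeckeCharacter.continuation_apply_one_ne_zero_of_differentiable`
(`HeckeLFunctionNonvanishingProofs`, Landau's method):

* `HeckeCharacter.eq_one_of_isNormTwist_of_map_posRealIdele` — a norm twist trivial on `A_G` is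
  trivial (`𝕀_K = 𝕀_K¹ · A_G`, `Automorphic.exists_normOneIdeles_mul_posRealIdele`, and norm
  twists kill `𝕀_K¹`); hence `ψ ≠ 1` trivial on `A_G` is not a norm twist, and neither is `ψ⁻¹`
  (`HeckeCharacter.IsNormTwist.of_inv`);
* `heckeLFunction_eq_prod_mul_tprod_compl` — for `Re s > 1` and finite `S` off which `ψ` is
  unramified, `L(s, ψ) = ∏_{v ∈ S} (1 - c_v N v^{-s})⁻¹ · L^S(s, ψ)` (`c_v = ψ(ϖ_v)` or `0`);
* `tendsto_partialHeckeL_of_continuation` — if `g` is an entire (indeed: holomorphic near `1`)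
  continuation of `L(s, ψ)`, then `L^S(s, ψ) → g(1) · ∏_{v ∈ S} (1 - c_v N v^{-1})` as `s → 1`,
  `Re s > 1`, and the finite product is non-zero;
* `JacquetShalika1981_partialPairL_at_one_of_ne_conj_one_of_tate` (**main**): the named fact
  for `n = 1` over `K`, from `∀ χ, heckeLFunction_hasEntireContinuation_of_not_isNormTwist χ`.

## References

* J. Arthur, L. Clozel, *Simple algebras, base change, and the advanced theory of the trace
  formula*, Ann. of Math. Stud. 120 (1989), Ch. 3 §2, (2.2), p. 171. [ArthurClozelAMS120]
* K. Iwasawa, *Hecke's `L`-functions* (lectures, Princeton, Spring 1964), SpringerBriefs (2019),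
  PDF p. 25, Thm. 3.1 (p. 58), Prop. 4.4 (p. 72). [Iwasawa2019]
* J. Tate, *Fourier analysis in number fields and Hecke's zeta-functions*, in Cassels–Fröhlich,
  *Algebraic Number Theory* (1967), Ch. XV, §4.3 and Thm. 4.4.1. [TateThesis1967]
-/

noncomputable section

open scoped MatrixGroups Topology NNReal ComplexConjugate
open NumberField IsDedekindDomain MeasureTheory Filter Complex Set

namespace Literature.NumberTheory.GaloisRepresentations.HeckeCharacter

open Literature.NumberTheory.Automorphic

variable {K : Type} [Field K] [NumberField K]

/-! ### Norm twists trivial on `A_G` are trivial -/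

/-- **A norm twist trivial on `A_G = ℝ_{>0}` is the trivial character.** Every idele is
`x = y · ρ(r)` with `‖y‖ = 1` and `r > 0` (Weil, *Basic Number Theory*, Ch. IV §4, Cor. 2 of
Thm. 5; the tree's `exists_normOneIdeles_mul_posRealIdele`); a norm twist `‖·‖^z` kills `y`
(Tate (1950), §4.3), and by hypothesis `χ(ρ(r)) = 1`. [cite: TateThesis1967, §4.3] -/
theorem eq_one_of_isNormTwist_of_map_posRealIdele {χ : HeckeCharacter K} (h : χ.IsNormTwist)
    (hA : ∀ t : ℝ≥0ˣ, χ (posRealIdele K t) = 1) : χ = 1 := by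
  ext x
  obtain ⟨y, hy, r, rfl⟩ := exists_normOneIdeles_mul_posRealIdele K x
  have hy1 : χ y = 1 := h.map_eq_one_of_ideleNorm_eq_one
    (by rw [← coe_ideleNorm, mem_normOneIdeles.mp hy, NNReal.coe_one])
  rw [map_mul, hy1, hA r, one_mul, one_apply]

/-- Hence a character `χ ≠ 1` trivial on `A_G` is **not a norm twist** — the hypothesis of
Hecke's theorem `heckeLFunction_hasEntireContinuation_of_not_isNormTwist` (Iwasawa's "`χ ≢ 1`"
for characters of `J/(F^* × T)`, Thm. 3.1). [cite: Iwasawa2019, Thm. 3.1] -/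
theorem not_isNormTwist_of_map_posRealIdele {χ : HeckeCharacter K}
    (hA : ∀ t : ℝ≥0ˣ, χ (posRealIdele K t) = 1) (h1 : χ ≠ 1) : ¬χ.IsNormTwist :=
  fun h => h1 (eq_one_of_isNormTwist_of_map_posRealIdele h hA)

/-- If `χ⁻¹` is a norm twist `‖·‖^z` then `χ = ‖·‖^{-z}` is one. [folklore] -/
theorem IsNormTwist.of_inv {χ : HeckeCharacter K} (h : χ⁻¹.IsNormTwist) : χ.IsNormTwist := by
  obtain ⟨z, hz⟩ := h
  refine ⟨-z, fun x => ?_⟩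
  have hx := hz x
  rw [inv_apply, Units.val_inv_eq_inv_val] at hx
  rw [Complex.cpow_neg, ← hx, inv_inv]

end Literature.NumberTheory.GaloisRepresentations.HeckeCharacter

namespace Literature.NumberTheory.Automorphic

open AdelicGroupData GaloisRepresentations

variable {K : Type} [Field K] [NumberField K]

/-! ### `L(s, ψ) = (finite Euler product over S) · L^S(s, ψ)` and the limit of `L^S` at `s = 1` -/

open scoped Classical in
/-- **Splitting off the places of `S`.** For unitary `ψ` unramified off the finite set `S` and
`Re s > 1`: `L(s, ψ) = ∏_{v ∈ S} (1 - c_v N v^{-s})⁻¹ · ∏'_{v ∉ S} (1 - ψ(ϖ_v) N v^{-s})⁻¹` with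
`c_v = ψ(ϖ_v)` at the unramified and `c_v = 0` at the ramified `v ∈ S` (Neukirch VII §8, remark
before (8.5): `L`-series differing by finitely many Euler factors; Mathlib
`Multipliable.tprod_mul_tprod_compl`). [cite: NeukirchANT1999, Ch. VII §8 (before (8.5))] -/
theorem heckeLFunction_eq_prod_mul_tprod_compl {ψ : HeckeCharacter K} (hψ : ψ.IsUnitary)
    (T : Finset (HeightOneSpectrum (𝓞 K))) (hur : ∀ v ∉ (T : Set (HeightOneSpectrum (𝓞 K))),
      ψ.IsUnramifiedAt v) {s : ℂ} (hs : 1 < s.re) :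
    heckeLFunction ψ s =
      (∏ v ∈ T, (1 - (if ψ.IsUnramifiedAt v then ψ.valueAtUniformizer v else 0) *
        ((Ideal.absNorm v.asIdeal : ℕ) : ℂ) ^ (-s))⁻¹) *
      ∏' v : {v : HeightOneSpectrum (𝓞 K) // v ∉ (T : Set (HeightOneSpectrum (𝓞 K)))},
        (1 - ψ.valueAtUniformizer v.1 * ((Ideal.absNorm v.1.asIdeal : ℕ) : ℂ) ^ (-s))⁻¹ := by
  rw [heckeLFunction_eq_tprod_ite]
  set F : HeightOneSpectrum (𝓞 K) → ℂ := fun v =>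
    (1 - (if ψ.IsUnramifiedAt v then ψ.valueAtUniformizer v else 0) *
      ((Ideal.absNorm v.asIdeal : ℕ) : ℂ) ^ (-s))⁻¹ with hF
  have hsumm : Summable fun v : HeightOneSpectrum (𝓞 K) =>
      ‖(if ψ.IsUnramifiedAt v then ψ.valueAtUniformizer v else 0) *
        ((Ideal.absNorm v.asIdeal : ℕ) : ℂ) ^ (-s)‖ := by
    refine Summable.of_nonneg_of_le (fun v => norm_nonneg _) (fun v => ?_)
      (LFunctions.summable_absNorm_rpow_neg hs)
    rw [norm_mul, Complex.norm_natCast_cpow_of_pos (LFunctions.absNorm_heightOneSpectrum_pos v),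
      Complex.neg_re]
    exact mul_le_of_le_one_left (Real.rpow_nonneg (Nat.cast_nonneg _) _)
      (norm_ite_valueAtUniformizer_le_one hψ v)
  have hT : Multipliable
      (F ∘ ((↑) : ↥(↑T : Set (HeightOneSpectrum (𝓞 K))) → HeightOneSpectrum (𝓞 K))) :=
    Multipliable.of_finite
  have hTc : Multipliable
      (F ∘ ((↑) : ↥((↑T : Set (HeightOneSpectrum (𝓞 K)))ᶜ) → HeightOneSpectrum (𝓞 K))) := by
    have h := multipliable_inv_one_sub_of_summable_norm
      (hsumm.subtype ((↑T : Set (HeightOneSpectrum (𝓞 K)))ᶜ))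
    exact h
  rw [← hT.tprod_mul_tprod_compl hTc, Finset.tprod_subtype' T F]
  congr 1
  exact tprod_congr fun v => by
    simp only [hF, if_pos (hur v.1 v.2)]

/-- The finite Euler product `E(s) = ∏_{v ∈ S} (1 - c_v N v^{-s})` (`|c_v| ≤ 1`) is continuous in
`s` and non-zero for `Re s > 0` (`|c_v N v^{-s}| ≤ N v^{-Re s} < 1`). [folklore] -/
theorem continuous_finset_prod_one_sub_mul_cpow (T : Finset (HeightOneSpectrum (𝓞 K)))
    (c : HeightOneSpectrum (𝓞 K) → ℂ) :
    Continuous fun s : ℂ => ∏ v ∈ T, (1 - c v * ((Ideal.absNorm v.asIdeal : ℕ) : ℂ) ^ (-s)) := by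
  refine continuous_finsetProd _ fun v _ => continuous_const.sub (continuous_const.mul ?_)
  exact Continuous.const_cpow continuous_id.neg
    (Or.inl (Nat.cast_ne_zero.mpr (LFunctions.absNorm_heightOneSpectrum_pos v).ne'))

/-- Non-vanishing of the finite Euler product on `Re s > 0`. [folklore] -/
theorem finset_prod_one_sub_mul_cpow_ne_zero (T : Finset (HeightOneSpectrum (𝓞 K)))
    {c : HeightOneSpectrum (𝓞 K) → ℂ} (hc : ∀ v, ‖c v‖ ≤ 1) {s : ℂ} (hs : 0 < s.re) :
    ∏ v ∈ T, (1 - c v * ((Ideal.absNorm v.asIdeal : ℕ) : ℂ) ^ (-s)) ≠ 0 := by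
  refine Finset.prod_ne_zero_iff.mpr fun v _ => sub_ne_zero.mpr fun h => ?_
  have hlt : ‖c v * ((Ideal.absNorm v.asIdeal : ℕ) : ℂ) ^ (-s)‖ < 1 := by
    rw [norm_mul, Complex.norm_natCast_cpow_of_pos (LFunctions.absNorm_heightOneSpectrum_pos v),
      Complex.neg_re]
    have hq : (1 : ℝ) < ((Ideal.absNorm v.asIdeal : ℕ) : ℝ) := by
      exact_mod_cast NumberField.HeightOneSpectrum.one_lt_absNorm v
    have hlt1 : ((Ideal.absNorm v.asIdeal : ℕ) : ℝ) ^ (-s.re) < 1 :=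
      Real.rpow_lt_one_of_one_lt_of_neg hq (by linarith)
    calc ‖c v‖ * ((Ideal.absNorm v.asIdeal : ℕ) : ℝ) ^ (-s.re)
        ≤ 1 * ((Ideal.absNorm v.asIdeal : ℕ) : ℝ) ^ (-s.re) := by
          gcongr
          exact hc v
      _ < 1 := by rw [one_mul]; exact hlt1
  rw [← h, norm_one] at hlt
  exact lt_irrefl _ hlt

open scoped Classical in
/-- **The limit of `L^S(s, ψ)` at `s = 1` from a continuation of `L(s, ψ)`.** Let `ψ` be unitary,
unramified off the finite `S`, and let `g` be holomorphic on a neighbourhood of `1` (e.g. entire)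
with `g = L(·, ψ)` on `Re s > 1`. Then
`L^S(s, ψ) → g(1) · ∏_{v ∈ S} (1 - c_v N v^{-1})` as `s → 1`, `Re s > 1` (`L^S = g · E` on
`Re s > 1` by `heckeLFunction_eq_prod_mul_tprod_compl`, and `g`, `E` are continuous at `1`).
[cite: NeukirchANT1999, Ch. VII §8 (before (8.5))] -/
theorem tendsto_partialHeckeL_of_continuation {ψ : HeckeCharacter K} (hψ : ψ.IsUnitary)
    (T : Finset (HeightOneSpectrum (𝓞 K))) (hur : ∀ v ∉ (T : Set (HeightOneSpectrum (𝓞 K))),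
      ψ.IsUnramifiedAt v) {g : ℂ → ℂ} (hg : ContinuousAt g 1)
    (hg_eq : ∀ s : ℂ, 1 < s.re → g s = heckeLFunction ψ s) :
    Tendsto (fun s : ℂ => ∏' v : {v : HeightOneSpectrum (𝓞 K) //
        v ∉ (T : Set (HeightOneSpectrum (𝓞 K)))},
        (1 - ψ.valueAtUniformizer v.1 * ((Ideal.absNorm v.1.asIdeal : ℕ) : ℂ) ^ (-s))⁻¹)
      (𝓝[{s : ℂ | 1 < s.re}] 1)
      (𝓝 (g 1 * ∏ v ∈ T, (1 - (if ψ.IsUnramifiedAt v then ψ.valueAtUniformizer v else 0) *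
        ((Ideal.absNorm v.asIdeal : ℕ) : ℂ) ^ (-(1 : ℂ))))) := by
  have hEc : Continuous fun s : ℂ => ∏ v ∈ T, (1 - (if ψ.IsUnramifiedAt v
      then ψ.valueAtUniformizer v else 0) * ((Ideal.absNorm v.asIdeal : ℕ) : ℂ) ^ (-s)) :=
    continuous_finset_prod_one_sub_mul_cpow T _
  have hlim := (hg.tendsto.mul (hEc.tendsto 1)).mono_left
    (nhdsWithin_le_nhds (s := {s : ℂ | 1 < s.re}) (a := (1 : ℂ)))
  refine hlim.congr' ?_
  filter_upwards [self_mem_nhdsWithin] with s hs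
  have hs1 : 1 < s.re := hs
  have hE0 : ∏ v ∈ T, (1 - (if ψ.IsUnramifiedAt v then ψ.valueAtUniformizer v else 0) *
      ((Ideal.absNorm v.asIdeal : ℕ) : ℂ) ^ (-s)) ≠ 0 :=
    finset_prod_one_sub_mul_cpow_ne_zero T (norm_ite_valueAtUniformizer_le_one hψ) (by linarith)
  have hsplit := heckeLFunction_eq_prod_mul_tprod_compl hψ T hur hs1
  rw [Finset.prod_inv_distrib] at hsplit
  show g s * (∏ v ∈ T, (1 - (if ψ.IsUnramifiedAt v then ψ.valueAtUniformizer v else 0) *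
      ((Ideal.absNorm v.asIdeal : ℕ) : ℂ) ^ (-s))) = _
  rw [hg_eq s hs1, hsplit, mul_comm, ← mul_assoc, mul_inv_cancel₀ hE0, one_mul]

open scoped Classical in
/-- The finite Euler product at `s = 1` is non-zero. [folklore] -/
theorem finset_prod_one_sub_mul_cpow_neg_one_ne_zero {ψ : HeckeCharacter K} (hψ : ψ.IsUnitary)
    (T : Finset (HeightOneSpectrum (𝓞 K))) :
    ∏ v ∈ T, (1 - (if ψ.IsUnramifiedAt v then ψ.valueAtUniformizer v else 0) *
      ((Ideal.absNorm v.asIdeal : ℕ) : ℂ) ^ (-(1 : ℂ))) ≠ 0 :=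
  finset_prod_one_sub_mul_cpow_ne_zero T (norm_ite_valueAtUniformizer_le_one hψ)
    (by rw [Complex.one_re]; exact one_pos)

/-! ### Arthur–Clozel (2.2) at `s = 1`, `n = 1`, over any number field, from Hecke's theorem -/

section Assembly

variable {μ : Measure (gl 1 K).automorphicQuotient} [(gl 1 K).IsAutomorphicMeasure μ]

/-- **Hecke–Landau in the limit form of `PairLFunctionPolesGLOneProofs`**, granted Hecke's
continuation theorem: for every unitary Hecke character `ψ` of `K` trivial on `A_G = ℝ_{>0}` with
`ψ ≠ 1` and every finite `S` off which `ψ` is unramified, `L^S(s, ψ)` has a finite **non-zero**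
limit as `s → 1`, `Re s > 1`. Ingredients: `ψ`, `ψ⁻¹` are not norm twists
(`not_isNormTwist_of_map_posRealIdele`), so `L(s, ψ^{±1})` have entire continuations `g`, `g'`
(hypothesis `hT`, Tate's Thm. 4.4.1 = Iwasawa's Thm. 3.1); `g(1) ≠ 0`
(`HeckeCharacter.continuation_apply_one_ne_zero_of_differentiable`, Iwasawa's Prop. 4.4); and
`L^S(s, ψ) → g(1) E(1) ≠ 0` (`tendsto_partialHeckeL_of_continuation`).
[cite: Iwasawa2019, Ch. 4 §4.2 Prop. 4.4] -/
theorem exists_ne_zero_tendsto_partialHeckeL_of_tate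
    (hT : ∀ χ : HeckeCharacter K, heckeLFunction_hasEntireContinuation_of_not_isNormTwist χ)
    (ψ : HeckeCharacter K) (hu : ψ.IsUnitary) (hA : ∀ t : ℝ≥0ˣ, ψ (posRealIdele K t) = 1)
    (h1 : ψ ≠ 1) {S : Set (HeightOneSpectrum (𝓞 K))} (hS : S.Finite)
    (hur : ∀ v ∉ S, ψ.IsUnramifiedAt v) :
    ∃ c : ℂ, c ≠ 0 ∧ Tendsto (fun s : ℂ => ∏' v : {v : HeightOneSpectrum (𝓞 K) // v ∉ S},
      (1 - ψ.valueAtUniformizer v.1 * ((v.1.residueCard : ℂ) ^ (-s)))⁻¹)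
      (𝓝[{s : ℂ | 1 < s.re}] 1) (𝓝 c) := by
  classical
  obtain ⟨T, rfl⟩ : ∃ T : Finset (HeightOneSpectrum (𝓞 K)), (T : Set _) = S :=
    ⟨hS.toFinset, hS.coe_toFinset⟩
  have hnt : ¬ψ.IsNormTwist := HeckeCharacter.not_isNormTwist_of_map_posRealIdele hA h1
  have hnt' : ¬ψ⁻¹.IsNormTwist := fun h => hnt (HeckeCharacter.IsNormTwist.of_inv h)
  obtain ⟨g, hg, hg_eq⟩ := hT ψ hu hnt
  obtain ⟨g', hg', hg'_eq⟩ := hT ψ⁻¹ hu.inv hnt'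
  have hg1 : g 1 ≠ 0 :=
    HeckeCharacter.continuation_apply_one_ne_zero_of_differentiable hu hg hg_eq hg' hg'_eq
  refine ⟨g 1 * ∏ v ∈ T, (1 - (if ψ.IsUnramifiedAt v then ψ.valueAtUniformizer v else 0) *
    ((Ideal.absNorm v.asIdeal : ℕ) : ℂ) ^ (-(1 : ℂ))),
    mul_ne_zero hg1 (finset_prod_one_sub_mul_cpow_neg_one_ne_zero hu T), ?_⟩
  exact tendsto_partialHeckeL_of_continuation hu T hur hg.continuous.continuousAt hg_eq

/-- **Arthur–Clozel (2.2) at `s = 1` for `GL_1` over any number field `K`, from Hecke's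
continuation theorem.** Granted the named fact
`heckeLFunction_hasEntireContinuation_of_not_isNormTwist χ` for the Hecke characters of `K`
(Tate (1950), Thm. 4.4.1; Iwasawa, Thm. 3.1), the named fact
`JacquetShalika1981_partialPairL_at_one_of_ne_conj` holds for `n = 1` over `K`: for cuspidal
`π, π' ≤ L²_cusp(GL_1(K) A_G \ GL_1(𝔸_K))` with `π ≠ π̄'` and honest Satake families `α`, `β` off a
finite `S`, `L^S(s, π × π') = L^S(s, χ_π χ_{π'})` has a finite non-zero limit as `s → 1`,
`Re s > 1` (`JacquetShalika1981_partialPairL_at_one_of_ne_conj_one_of_heckeCharacter` fed with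
`exists_ne_zero_tendsto_partialHeckeL_of_tate`; the non-vanishing is the tree's theorem
`HeckeCharacter.continuation_apply_one_ne_zero_of_differentiable`, Iwasawa's Prop. 4.4). The
case `K = ℚ` is unconditional (`JacquetShalika1981_partialPairL_at_one_of_ne_conj_one_rat`).
[cite: ArthurClozelAMS120, Ch. 3 §2 (2.2)] -/
theorem JacquetShalika1981_partialPairL_at_one_of_ne_conj_one_of_tate
    (hT : ∀ χ : HeckeCharacter K, heckeLFunction_hasEntireContinuation_of_not_isNormTwist χ) :
    JacquetShalika1981_partialPairL_at_one_of_ne_conj (n := 1) (K := K) (μ := μ) :=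
  JacquetShalika1981_partialPairL_at_one_of_ne_conj_one_of_heckeCharacter
    fun ψ hu hA h1 _ hS hur => exists_ne_zero_tendsto_partialHeckeL_of_tate hT ψ hu hA h1 hS hur

end Assembly

end Literature.NumberTheory.Automorphic
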